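import Summits.AtomisticToContinuum.Crystallization.Theorems.FreeSplittingCertificatesStrictSplittingRuleFarPencilFlux
import Summits.AtomisticToContinuum.Crystallization.Theorems.FreeSplittingCertificatesStrictSplittingRuleFarPencilInflated
import Summits.AtomisticToContinuum.Crystallization.Theorems.FreeSplittingCertificatesStrictSplittingRuleFarPencilInflatedB
import Summits.AtomisticToContinuum.Crystallization.Theorems.FreeSplittingCertificatesStrictSplittingRuleFarPencilInflatedC
import Summits.AtomisticToContinuum.Crystallization.Theorems.FreeSplittingCertificatesStrictSplittingRuleFarPencilInflatedD

/-!
# `StrictSplittingRule` (stmt-AtomisticToContinuum-12560): the GENERIC far-pencil flux `Φ = aΦ₁ + bΦ₂ + cΦ₃ + n₁Ψ₁` — objects, certificates, calculus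

Route `FreeSplittingCertificates`, crux r3 `StrictSplittingRule` (H12⋆ = `stub_coreJointCoercive`), unit b2b-freesplit-B gen 17.
VALUE = the calculus layer that lets EVERY pointwise far certificate of the cell (the `f = 1` pencil of `…FarPencilPointwise` and the four
INFLATED pencils `…FarPencilInflated{,B,C,D}` of gen 16, HOME CERT.md §23) be integrated by one chain of theorems — NOT a proof of H12⋆,
NOT summit progress.

The integrated far theorems of the tree (`…FarPencilIntegral`, `…Weighted`, `…WeightedIntegrable`, `…GrowthIntegral`, `…LocallyAffine`) are written
for the ONE flux `fpFlux = |x|⁻⁸|v|²x + 7|x|⁻⁸⟪x,v⟫v + |x|⁻⁶((v·∇)v − (div v)v)` of the `17/200` pencil.  The assembly of H12⋆ cites an inflated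
certificate (recommended: D, `…FarPencilInflatedD`), whose flux is a different combination of the four covariant fluxes
`Φ₁ = |x|⁻⁸|v|²x`, `Φ₂ = |x|⁻⁸⟪x,v⟫v`, `Φ₃ = |x|⁻¹⁰⟪x,v⟫²x`, `Ψ₁ = |x|⁻⁶((v·∇)v − (div v)v)` (HOME FAR-LEMMA-SPEC §14 (b), (e) item (6)).
This file sets up the generic objects once:
* `fpNumI fS fA D C` — the inflated demand density `(f_S/24)s⁻³|sym G|² + (f_A/24)s⁻³|anti G|² + ((7D+C)/4)s⁻⁵⟪x,v⟫² − (C/4)s⁻⁴|v|²`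
  (`fpNum = fpNumI 1 1 1 1`, `fpNum_eq_fpNumI`);
* `fpDivFlux4 a b c n` — the pointwise divergence of `aΦ₁ + bΦ₂ + cΦ₃ + nΨ₁` in `(x, v, G = ∇v)` (`(1/18)·fpDivFlux = fpDivFlux4 (1/18) (7/18) 0 (1/18)`,
  `fpDivFlux_eq_fpDivFlux4`);
* the pointwise certificates `fpNumI + fpDivFlux4 ≤ t·fpDen` at every `x ≠ 0` (an explicit `∀`-hypothesis of the integrated theorems, no definition),
  DISCHARGED for the five landed certificates: `farPencilCert_one` (`17/200`), `farPencilCert_A` (`3/10`), `farPencilCert_B` (`27/50`),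
  `farPencilCert_C` (`29/40`), `farPencilCert_D` (`9/40`); monotone in the demand parameters (`farPencilCert_mono`);
* `fpFlux4 a b c n v y j` — the flux along an honest field `v : ℝ³ → ℝ³`, its explicit line derivative `fpFlux4Deriv`, the trace identity
  `Σⱼ ∂ⱼΦⱼ = fpDivFlux4 + n·|x|⁻⁶Σᵢⱼvᵢ(∂ⱼ∂ᵢvⱼ − ∂ᵢ∂ⱼvⱼ)` (`sum_fpFlux4Deriv_eq`; `= fpDivFlux4` for `C²` fields), the line derivatives
  `hasLineDerivAt_fpFlux4`, vanishing off the support, and `fpFlux = fpFlux4 1 7 0 1` (`fpFlux_eq_fpFlux4`).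
The integration (weighted integration by parts, decay along affine-tailed fields, passage to the P1 class) is in the companion files
`…FarPencilFlux4Integral`, `…FarPencilFlux4Growth`, `…FarPencilFlux4LocallyAffine`.
HONEST FRAMING: multivariable calculus and polynomial algebra about explicit fluxes; NOT a proof of H12⋆, NOT summit progress.
-/

noncomputable section

namespace Summit.AtomisticToContinuum.Crystallization.Theorems.StrictSplittingRuleBirth

/-! ## Objects in the free variables `(x, v, G)` -/

/-- The INFLATED demand density `N(f_S,f_A,D,C) = (f_S/24)s⁻³|sym G|² + (f_A/24)s⁻³|anti G|² + ((7D+C)/4)s⁻⁵⟪x,v⟫² − (C/4)s⁻⁴|v|²`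
(`s = |x|²`; readout split into symmetric / antisymmetric parts of the gradient, bare radial deficit inflated by `D`, tangential credit
deflated by `C`; HOME CERT.md §23 (1)). -/
def fpNumI (fS fA D C : ℝ) (x v : Fin 3 → ℝ) (G : Fin 3 → Fin 3 → ℝ) : ℝ :=
  fS * (1 / 24 * (fpSq x)⁻¹ ^ 3 * fpSymSq G) + fA * (1 / 24 * (fpSq x)⁻¹ ^ 3 * (fpFrob G - fpSymSq G)) +
      (7 * D + C) / 4 * (fpSq x)⁻¹ ^ 5 * fpDot x v ^ 2 -
    C / 4 * (fpSq x)⁻¹ ^ 4 * (v 0 ^ 2 + v 1 ^ 2 + v 2 ^ 2)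

/-- The pointwise divergence of the generic flux `aΦ₁ + bΦ₂ + cΦ₃ + nΨ₁` written in `(x, v, G = ∇v)`:
`a·s⁻⁴(−5|v|² + 2xᵀGv) + b·[s⁻⁴(|v|² + vᵀGx + ⟪x,v⟫tr G) − 8s⁻⁵⟪x,v⟫²] + c·s⁻⁵(2⟪x,v⟫xᵀGx − 5⟪x,v⟫²) + n·[s⁻³(tr(G²) − (tr G)²) − 6s⁻⁴(vᵀGx − ⟪x,v⟫tr G)]`. -/
def fpDivFlux4 (a b c n : ℝ) (x v : Fin 3 → ℝ) (G : Fin 3 → Fin 3 → ℝ) : ℝ :=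
  a * ((fpSq x)⁻¹ ^ 4 * (-5 * (v 0 ^ 2 + v 1 ^ 2 + v 2 ^ 2) + 2 * fpXGV x v G)) +
      b * ((fpSq x)⁻¹ ^ 4 * ((v 0 ^ 2 + v 1 ^ 2 + v 2 ^ 2) + fpVGX x v G + fpDot x v * fpTr G) -
        8 * (fpSq x)⁻¹ ^ 5 * fpDot x v ^ 2) +
      c * (2 * (fpSq x)⁻¹ ^ 5 * (fpDot x v * fpXGV x x G) - 5 * (fpSq x)⁻¹ ^ 5 * fpDot x v ^ 2) +
    n * ((fpSq x)⁻¹ ^ 3 * (fpTrSq G - fpTr G ^ 2) - 6 * (fpSq x)⁻¹ ^ 4 * (fpVGX x v G - fpDot x v * fpTr G))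

/-- `fpNum = N(1,1,1,1)`. -/
theorem fpNum_eq_fpNumI (x v : Fin 3 → ℝ) (G : Fin 3 → Fin 3 → ℝ) : fpNum x v G = fpNumI 1 1 1 1 x v G := by
  unfold fpNum fpNumI
  ring

/-- `(1/18)·fpDivFlux = fpDivFlux4 (1/18) (7/18) 0 (1/18)` (the `17/200` pencil's flux `(1/18)(Φ₁ + 7Φ₂ + Ψ₁)`). -/
theorem fpDivFlux_eq_fpDivFlux4 (x v : Fin 3 → ℝ) (G : Fin 3 → Fin 3 → ℝ) :
    1 / 18 * fpDivFlux x v G = fpDivFlux4 (1 / 18) (7 / 18) 0 (1 / 18) x v G := by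
  unfold fpDivFlux fpDivFlux4
  ring

/-- A POINTWISE FAR CERTIFICATE with demand parameters `(f_S, f_A, D, C)`, flux coefficients `(a, b, c, n)` and receipts coefficient `t` is the
statement `∀ x v G, x ≠ 0 → fpNumI fS fA D C x v G + fpDivFlux4 a b c n x v G ≤ t * fpDen x G` (kept as an explicit hypothesis, no definition).
It is monotone in the demand parameters: it serves every smaller `f_S, f_A, D` and every larger `C` (`fpNumInfl_mono`). -/
theorem farPencilCert_mono {fS fA D C a b c n t fS' fA' D' C' : ℝ}
    (h : ∀ (x v : Fin 3 → ℝ) (G : Fin 3 → Fin 3 → ℝ), x ≠ 0 → fpNumI fS fA D C x v G + fpDivFlux4 a b c n x v G ≤ t * fpDen x G)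
    (hfS : fS' ≤ fS) (hfA : fA' ≤ fA) (hD : D' ≤ D) (hC : C ≤ C') (x v : Fin 3 → ℝ) (G : Fin 3 → Fin 3 → ℝ) (hx : x ≠ 0) :
    fpNumI fS' fA' D' C' x v G + fpDivFlux4 a b c n x v G ≤ t * fpDen x G := by
  have h1 := h x v G hx
  have h2 := fpNumInfl_mono x v G hx hfS hfA hD hC
  unfold fpNumI at h1 ⊢
  linarith

/-! ## The five landed certificates in the vocabulary `fpNumI + fpDivFlux4 ≤ t·fpDen` -/

/-- The `17/200` pencil (`farPencil_pointwise_le`): `N(1,1,1,1) + div((1/18)(Φ₁ + 7Φ₂ + Ψ₁)) ≤ (17/200)Den`. -/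
theorem farPencilCert_one (x v : Fin 3 → ℝ) (G : Fin 3 → Fin 3 → ℝ) (hx : x ≠ 0) :
    fpNumI 1 1 1 1 x v G + fpDivFlux4 (1 / 18) (7 / 18) 0 (1 / 18) x v G ≤ 17 / 200 * fpDen x G := by
  have h := farPencil_pointwise_le x v G hx
  rw [← fpNum_eq_fpNumI, ← fpDivFlux_eq_fpDivFlux4]
  exact h

/-- Certificate A (`farPencilInflated_pointwise_le`): `(f_S,f_A,D,C) = (3,2,6/5,9/10)`, flux `(1/5, 11/12, −13/24, 31/360)`, `t = 3/10`. -/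
theorem farPencilCert_A (x v : Fin 3 → ℝ) (G : Fin 3 → Fin 3 → ℝ) (hx : x ≠ 0) :
    fpNumI 3 2 (6 / 5) (9 / 10) x v G + fpDivFlux4 (1 / 5) (11 / 12) (-(13 / 24)) (31 / 360) x v G ≤ 3 / 10 * fpDen x G := by
  have h := farPencilInflated_pointwise_le x v G hx
  unfold fpNumI fpDivFlux4
  linarith

/-- Certificate B (`farPencilInflatedB_pointwise_le`): `(16/5,16/5,5/4,3/4)`, flux `(259/720, 1111/720, −413/360, 247/1800)`, `t = 27/50`. -/
theorem farPencilCert_B (x v : Fin 3 → ℝ) (G : Fin 3 → Fin 3 → ℝ) (hx : x ≠ 0) :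
    fpNumI (16 / 5) (16 / 5) (5 / 4) (3 / 4) x v G + fpDivFlux4 (259 / 720) (1111 / 720) (-(413 / 360)) (247 / 1800) x v G ≤
      27 / 50 * fpDen x G := by
  have h := farPencilInflatedB_pointwise_le x v G hx
  unfold fpNumI fpDivFlux4
  linarith

/-- Certificate C (`farPencilInflatedC_pointwise_le`): `(5,4,5/4,3/4)`, flux `(163/360, 173/90, −143/120, 61/360)`, `t = 29/40`. -/
theorem farPencilCert_C (x v : Fin 3 → ℝ) (G : Fin 3 → Fin 3 → ℝ) (hx : x ≠ 0) :
    fpNumI 5 4 (5 / 4) (3 / 4) x v G + fpDivFlux4 (163 / 360) (173 / 90) (-(143 / 120)) (61 / 360) x v G ≤ 29 / 40 * fpDen x G := by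
  have h := farPencilInflatedC_pointwise_le x v G hx
  unfold fpNumI fpDivFlux4
  linarith

/-- Certificate D (`farPencilInflatedD_pointwise_le`, the RECOMMENDED target of the transfer): `(7/4,7/4,6/5,9/10)`,
flux `(7/45, 23/30, −19/40, 3/40)`, `t = 9/40`. -/
theorem farPencilCert_D (x v : Fin 3 → ℝ) (G : Fin 3 → Fin 3 → ℝ) (hx : x ≠ 0) :
    fpNumI (7 / 4) (7 / 4) (6 / 5) (9 / 10) x v G + fpDivFlux4 (7 / 45) (23 / 30) (-(19 / 40)) (3 / 40) x v G ≤ 9 / 40 * fpDen x G := by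
  have h := farPencilInflatedD_pointwise_le x v G hx
  unfold fpNumI fpDivFlux4
  linarith

/-! ## The generic flux along a field and its line derivative -/

/-- The generic flux `Φⱼ(y) = |y|⁻⁸(a|v|²yⱼ + b⟪y,v⟫vⱼ) + c|y|⁻¹⁰⟪y,v⟫²yⱼ + n|y|⁻⁶(Σᵢvᵢ∂ᵢvⱼ − (div v)vⱼ)` along the field `v`
(`|y|⁻² = (fpSq y)⁻¹`, so `Φ(0) = 0`). -/
def fpFlux4 (a b c n : ℝ) (v : (Fin 3 → ℝ) → (Fin 3 → ℝ)) (y : Fin 3 → ℝ) (j : Fin 3) : ℝ :=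
  (fpSq y)⁻¹ ^ 4 * (a * fpSq (v y) * y j + b * fpDot y (v y) * v y j) +
      c * ((fpSq y)⁻¹ ^ 5 * fpDot y (v y) ^ 2 * y j) +
    n * ((fpSq y)⁻¹ ^ 3 *
      (v y 0 * fpGrad v y 0 j + v y 1 * fpGrad v y 1 j + v y 2 * fpGrad v y 2 j - fpTr (fpGrad v y) * v y j))

/-- `fpFlux = fpFlux4 1 7 0 1`. -/
theorem fpFlux_eq_fpFlux4 (v : (Fin 3 → ℝ) → (Fin 3 → ℝ)) (y : Fin 3 → ℝ) (j : Fin 3) :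
    fpFlux v y j = fpFlux4 1 7 0 1 v y j := by
  unfold fpFlux fpFlux4
  ring

/-- The directional derivative `∂ₖΦⱼ(x)` of the generic flux by the product rule, in `x`, `v x`, `G = fpGrad v x`, `H = fpHess v x`. -/
def fpFlux4Deriv (a b c n : ℝ) (v : (Fin 3 → ℝ) → (Fin 3 → ℝ)) (x : Fin 3 → ℝ) (j k : Fin 3) : ℝ :=
  -8 * fpDot x (fpE k) * (fpSq x)⁻¹ ^ 5 * (a * fpSq (v x) * x j + b * fpDot x (v x) * v x j) +
        (fpSq x)⁻¹ ^ 4 *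
          (a * (2 * (v x 0 * fpGrad v x k 0 + v x 1 * fpGrad v x k 1 + v x 2 * fpGrad v x k 2)) * x j +
              a * fpSq (v x) * fpE k j +
            b * (fpDot (fpE k) (v x) + (x 0 * fpGrad v x k 0 + x 1 * fpGrad v x k 1 + x 2 * fpGrad v x k 2)) * v x j +
            b * fpDot x (v x) * fpGrad v x k j) +
      c * (-10 * fpDot x (fpE k) * (fpSq x)⁻¹ ^ 6 * fpDot x (v x) ^ 2 * x j +
        (fpSq x)⁻¹ ^ 5 *
          (2 * fpDot x (v x) * (fpDot (fpE k) (v x) + (x 0 * fpGrad v x k 0 + x 1 * fpGrad v x k 1 + x 2 * fpGrad v x k 2)) *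
              x j + fpDot x (v x) ^ 2 * fpE k j)) +
    n * (-6 * fpDot x (fpE k) * (fpSq x)⁻¹ ^ 4 *
          (v x 0 * fpGrad v x 0 j + v x 1 * fpGrad v x 1 j + v x 2 * fpGrad v x 2 j - fpTr (fpGrad v x) * v x j) +
        (fpSq x)⁻¹ ^ 3 *
          (fpGrad v x k 0 * fpGrad v x 0 j + fpGrad v x k 1 * fpGrad v x 1 j + fpGrad v x k 2 * fpGrad v x 2 j +
              (v x 0 * fpHess v x k 0 j + v x 1 * fpHess v x k 1 j + v x 2 * fpHess v x k 2 j) -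
            (fpHess v x k 0 0 + fpHess v x k 1 1 + fpHess v x k 2 2) * v x j -
            fpTr (fpGrad v x) * fpGrad v x k j))

/-- **Trace of the generic flux derivative** (pure algebra, `x ≠ 0`): `Σⱼ ∂ⱼΦⱼ = fpDivFlux4 a b c n + n·|x|⁻⁶Σᵢⱼ vᵢ(∂ⱼ∂ᵢvⱼ − ∂ᵢ∂ⱼvⱼ)`. -/
theorem sum_fpFlux4Deriv_eq (a b c n : ℝ) (v : (Fin 3 → ℝ) → (Fin 3 → ℝ)) {x : Fin 3 → ℝ} (hx : x ≠ 0) :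
    fpFlux4Deriv a b c n v x 0 0 + fpFlux4Deriv a b c n v x 1 1 + fpFlux4Deriv a b c n v x 2 2 =
      fpDivFlux4 a b c n x (v x) (fpGrad v x) +
        n * ((fpSq x)⁻¹ ^ 3 * ∑ i : Fin 3, ∑ j : Fin 3, v x i * (fpHess v x j i j - fpHess v x i j j)) := by
  have hρ : x 0 ^ 2 + x 1 ^ 2 + x 2 ^ 2 ≠ 0 := fpSq_ne_zero hx
  have h10 : fpE (1 : Fin 3) 0 = 0 := fpE_apply_of_ne (by decide)
  have h20 : fpE (2 : Fin 3) 0 = 0 := fpE_apply_of_ne (by decide)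
  have h01 : fpE (0 : Fin 3) 1 = 0 := fpE_apply_of_ne (by decide)
  have h21 : fpE (2 : Fin 3) 1 = 0 := fpE_apply_of_ne (by decide)
  have h02 : fpE (0 : Fin 3) 2 = 0 := fpE_apply_of_ne (by decide)
  have h12 : fpE (1 : Fin 3) 2 = 0 := fpE_apply_of_ne (by decide)
  simp only [fpFlux4Deriv, fpDivFlux4, Fin.sum_univ_three, fpDot, fpTr, fpTrSq, fpXGV, fpVGX, fpSq, fpE_apply_same,
    h10, h20, h01, h21, h02, h12]
  have hu : (x 0 ^ 2 + x 1 ^ 2 + x 2 ^ 2)⁻¹ * (x 0 ^ 2 + x 1 ^ 2 + x 2 ^ 2) = 1 := inv_mul_cancel₀ hρ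
  -- `u⁵·|x|² = u⁴` and `u⁶·|x|² = u⁵` are the only non-polynomial steps
  have key1 : (x 0 ^ 2 + x 1 ^ 2 + x 2 ^ 2)⁻¹ ^ 5 * (x 0 * x 0 + x 1 * x 1 + x 2 * x 2) =
      (x 0 ^ 2 + x 1 ^ 2 + x 2 ^ 2)⁻¹ ^ 4 := by
    have : x 0 * x 0 + x 1 * x 1 + x 2 * x 2 = x 0 ^ 2 + x 1 ^ 2 + x 2 ^ 2 := by ring
    rw [this, pow_succ, mul_assoc, hu, mul_one]
  have key2 : (x 0 ^ 2 + x 1 ^ 2 + x 2 ^ 2)⁻¹ ^ 6 * (x 0 * x 0 + x 1 * x 1 + x 2 * x 2) =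
      (x 0 ^ 2 + x 1 ^ 2 + x 2 ^ 2)⁻¹ ^ 5 := by
    have : x 0 * x 0 + x 1 * x 1 + x 2 * x 2 = x 0 ^ 2 + x 1 ^ 2 + x 2 ^ 2 := by ring
    rw [this, pow_succ, mul_assoc, hu, mul_one]
  linear_combination (-8 * a * (v x 0 ^ 2 + v x 1 ^ 2 + v x 2 ^ 2)) * key1 +
    (-10 * c * (x 0 * v x 0 + x 1 * v x 1 + x 2 * v x 2) ^ 2) * key2

/-- If the second derivative is symmetric, the trace of the generic flux derivative IS `fpDivFlux4`. -/
theorem sum_fpFlux4Deriv_eq_fpDivFlux4 (a b c n : ℝ) (v : (Fin 3 → ℝ) → (Fin 3 → ℝ)) {x : Fin 3 → ℝ} (hx : x ≠ 0)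
    (hsymm : ∀ k i j, fpHess v x k i j = fpHess v x i k j) :
    fpFlux4Deriv a b c n v x 0 0 + fpFlux4Deriv a b c n v x 1 1 + fpFlux4Deriv a b c n v x 2 2 =
      fpDivFlux4 a b c n x (v x) (fpGrad v x) := by
  rw [sum_fpFlux4Deriv_eq a b c n v hx]
  have : ∑ i : Fin 3, ∑ j : Fin 3, v x i * (fpHess v x j i j - fpHess v x i j j) = 0 := by
    refine Finset.sum_eq_zero fun i _ => Finset.sum_eq_zero fun j _ => ?_
    rw [hsymm j i j, sub_self, mul_zero]
  rw [this, mul_zero, mul_zero, add_zero]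

/-- `div Φ = fpDivFlux4` at every `x ≠ 0` where `v` is `C²`. -/
theorem sum_fpFlux4Deriv_eq_fpDivFlux4_of_contDiffAt (a b c n : ℝ) (v : (Fin 3 → ℝ) → (Fin 3 → ℝ)) {x : Fin 3 → ℝ}
    (hx : x ≠ 0) (hv : ContDiffAt ℝ 2 v x) :
    fpFlux4Deriv a b c n v x 0 0 + fpFlux4Deriv a b c n v x 1 1 + fpFlux4Deriv a b c n v x 2 2 =
      fpDivFlux4 a b c n x (v x) (fpGrad v x) :=
  sum_fpFlux4Deriv_eq_fpDivFlux4 a b c n v hx (fpHess_symm_of_contDiffAt hv)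

/-- **The generic flux has the stated directional derivatives**: at every `x ≠ 0` where `v` and `∇v` are differentiable,
`∂ₖΦⱼ(x) = fpFlux4Deriv a b c n v x j k` as a line derivative along `eₖ`. -/
theorem hasLineDerivAt_fpFlux4 (a b c n : ℝ) {v : (Fin 3 → ℝ) → (Fin 3 → ℝ)} {x : Fin 3 → ℝ} (hx : x ≠ 0)
    (hv : DifferentiableAt ℝ v x) (hv2 : DifferentiableAt ℝ (fderiv ℝ v) x) (j k : Fin 3) :
    HasLineDerivAt ℝ (fun y => fpFlux4 a b c n v y j) (fpFlux4Deriv a b c n v x j k) x (fpE k) := by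
  have hX := hasDerivAt_fpLine_apply x (fpE k)
  have hV := hasDerivAt_fpField_line hv k
  have hG := hasDerivAt_fpGrad_line hv2 k
  have hu := hasDerivAt_fpSq_inv_line hx (fpE k)
  -- |v|² and ⟪x,v⟫ along the line
  have hS : HasDerivAt (fun t : ℝ => fpSq (v (x + t • fpE k)))
      (2 * (v x 0 * fpGrad v x k 0 + v x 1 * fpGrad v x k 1 + v x 2 * fpGrad v x k 2)) 0 := by
    have h := (((hV 0).pow 2).add ((hV 1).pow 2)).add ((hV 2).pow 2)
    refine (h.congr_deriv ?_).congr_of_eventuallyEq (Filter.Eventually.of_forall fun t => rfl)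
    simp only [zero_smul, add_zero]
    norm_num
    ring
  have hD : HasDerivAt (fun t : ℝ => fpDot (x + t • fpE k) (v (x + t • fpE k)))
      (fpDot (fpE k) (v x) + (x 0 * fpGrad v x k 0 + x 1 * fpGrad v x k 1 + x 2 * fpGrad v x k 2)) 0 := by
    have h := (((hX 0).mul (hV 0)).add ((hX 1).mul (hV 1))).add ((hX 2).mul (hV 2))
    refine (h.congr_deriv ?_).congr_of_eventuallyEq (Filter.Eventually.of_forall fun t => rfl)
    simp only [zero_smul, add_zero, fpDot]
    ring
  have hT : HasDerivAt (fun t : ℝ => fpTr (fpGrad v (x + t • fpE k)))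
      (fpHess v x k 0 0 + fpHess v x k 1 1 + fpHess v x k 2 2) 0 :=
    ((hG 0 0).add (hG 1 1)).add (hG 2 2)
  -- the three summands of Φⱼ
  have h1 := (hu.pow 4).mul ((((hS.const_mul a).mul (hX j))).add (((hD.const_mul b).mul (hV j))))
  have h2 := (((hu.pow 5).mul (hD.pow 2)).mul (hX j)).const_mul c
  have h3 := ((hu.pow 3).mul
    (((((hV 0).mul (hG 0 j)).add ((hV 1).mul (hG 1 j))).add ((hV 2).mul (hG 2 j))).sub (hT.mul (hV j)))).const_mul n
  have h := (h1.add h2).add h3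
  refine (h.congr_deriv ?_).congr_of_eventuallyEq (Filter.Eventually.of_forall fun t => rfl)
  simp only [zero_smul, add_zero, fpFlux4Deriv]
  norm_num
  ring

/-! ## Off the support -/

/-- The generic flux vanishes where the field and its gradient vanish. -/
theorem fpFlux4_eq_zero (a b c n : ℝ) {v : (Fin 3 → ℝ) → (Fin 3 → ℝ)} {y : Fin 3 → ℝ} (hv : v y = 0)
    (hG : fderiv ℝ v y = 0) (j : Fin 3) : fpFlux4 a b c n v y j = 0 := by
  simp [fpFlux4, fpGrad, hv, hG, fpSq, fpDot, fpTr]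

/-- The generic flux derivative vanishes where the field, its gradient and its second derivative vanish. -/
theorem fpFlux4Deriv_eq_zero (a b c n : ℝ) {v : (Fin 3 → ℝ) → (Fin 3 → ℝ)} {y : Fin 3 → ℝ} (hv : v y = 0)
    (hG : fderiv ℝ v y = 0) (hH : fderiv ℝ (fderiv ℝ v) y = 0) (j k : Fin 3) : fpFlux4Deriv a b c n v y j k = 0 := by
  simp [fpFlux4Deriv, fpGrad, fpHess, hv, hG, hH, fpSq, fpDot, fpTr]

end Summit.AtomisticToContinuum.Crystallization.Theorems.StrictSplittingRuleBirth
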